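import Mathlib
import HarnessLib

/-!
# Newton sums at a pole: `Σ_{h(β)=0} (β − γ)^{−s}` is determined by `h mod (X − γ)^{s+1}`

Topic `Literature/NumberTheory/LFunctions` (exponential sums), grouping namespace
`RationalExpSum`.  First file of the elementary (Schmidt-style) treatment of the `L`-function of
the additive character sums `Σ_x ψ(P(x)/Q(x))` of a RATIONAL function over a finite field
(A. Weil, *On some exponential sums*, Proc. Nat. Acad. Sci. 34 (1948); the `L`-function
formalism of W. M. Schmidt, *Equations over finite fields*, LNM 536 (1976), Ch. II §§6–10,
there carried out for polynomial arguments and for Kloosterman sums).  For a rational function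
the multiplicative function `h ↦ ψ(Σ_{h(β)=0} P(β)/Q(β))` on monic polynomials is a character
"modulo `Q · rad Q`" — the present file proves the algebraic heart of that statement:

* `invPowerSum h γ s = Σ_{β ∈ roots h} (β − γ)^{−s}` (roots with multiplicity, over a field in
  which `h` splits);
* **Newton's recursion at a pole** (`natCast_mul_coeff_taylor_eq`): if `h` splits and
  `h(γ) ≠ 0`, the Taylor coefficients `d_j` of `h` at `γ` satisfy
  `k d_k = − Σ_{i=1}^{k} u_i d_{k−i}` (`u_i = invPowerSum h γ i`) for every `k ≥ 1` — Newton's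
  identities (Mathlib's `MvPolynomial.mul_esymm_eq_sum`) for the inverses of the shifted roots,
  whose elementary symmetric functions are `(−1)^j d_j / d_0` (`coeff_taylor_eq`);
* hence (`invPowerSum_eq_of_coeff_taylor_eq`, `invPowerSum_eq_of_dvd_sub`) `u_1, …, u_m` are
  determined by `d_0, …, d_m`, i.e. by `h mod (X − γ)^{m+1}`.

Everything is proved; no named facts.

## References

* W. M. Schmidt, *Equations over Finite Fields. An Elementary Approach*, LNM 536 (1976),
  Ch. II §6 (Newton's formulae (6.5)–(6.7)). [`Schmidt1976`]
* A. Weil, *On some exponential sums*, Proc. Nat. Acad. Sci. USA 34 (1948) 204–207. [`Weil1948`]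
-/

noncomputable section

open Finset Polynomial

namespace Literature.NumberTheory.LFunctions

namespace RationalExpSum

/-! ### Newton's identities at a point, over any commutative ring -/

section Newton

variable {L : Type*} [CommRing L]

/-- `Σ_{a+b=k, a<k} g(a, b) = Σ_{i=1}^{k} g(k−i, i)`. [folklore] -/
theorem sum_antidiagonal_filter_fst_lt {M : Type*} [AddCommMonoid M] (k : ℕ) (g : ℕ × ℕ → M) :
    ∑ a ∈ (HasAntidiagonal.antidiagonal k).filter (fun a : ℕ × ℕ => a.1 < k), g a =
      ∑ i ∈ Finset.Icc 1 k, g (k - i, i) := by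
  refine Finset.sum_nbij' (fun a => a.2) (fun i => (k - i, i)) ?_ ?_ ?_ ?_ ?_
  · intro a ha
    simp only [Finset.mem_filter, Finset.HasAntidiagonal.mem_antidiagonal] at ha
    simp only [Finset.mem_Icc]
    omega
  · intro i hi
    simp only [Finset.mem_Icc] at hi
    simp only [Finset.mem_filter, Finset.HasAntidiagonal.mem_antidiagonal]
    omega
  · intro a ha
    simp only [Finset.mem_filter, Finset.HasAntidiagonal.mem_antidiagonal] at ha
    obtain ⟨a1, a2⟩ := a
    simp only [Prod.mk.injEq, and_true]
    simp only at ha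
    omega
  · intro i _
    rfl
  · intro a ha
    simp only [Finset.mem_filter, Finset.HasAntidiagonal.mem_antidiagonal] at ha
    obtain ⟨a1, a2⟩ := a
    simp only at ha ⊢
    rw [show k - a2 = a1 by omega]

/-- **Newton's identities at a point** over a commutative ring: for `ω : σ → L` with
elementary symmetric functions `E_j` and power sums `P_i = Σ ω^i`,
`k (−1)^k E_k = Σ_{i=1}^{k} (−P_i) (−1)^{k−i} E_{k−i}` (Mathlib's `MvPolynomial.mul_esymm_eq_sum`
evaluated at `ω`). [cite: Schmidt1976, Ch. II §6, (6.5)] -/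
theorem newton_eval {σ : Type*} [Fintype σ] [DecidableEq σ] (ω : σ → L) (k : ℕ) :
    (k : L) * ((-1) ^ k * (Finset.univ.val.map ω).esymm k) =
      ∑ i ∈ Finset.Icc 1 k, (-∑ x, ω x ^ i) *
        ((-1) ^ (k - i) * (Finset.univ.val.map ω).esymm (k - i)) := by
  have h := congrArg (MvPolynomial.aeval ω) (MvPolynomial.mul_esymm_eq_sum σ L k)
  have hpsum : ∀ m, MvPolynomial.aeval ω (MvPolynomial.psum σ L m) = ∑ x, ω x ^ m := by
    intro m; simp [MvPolynomial.psum]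
  simp only [map_mul, map_natCast, map_pow, map_neg, map_one, map_sum,
    MvPolynomial.aeval_esymm_eq_multiset_esymm, hpsum] at h
  set E : ℕ → L := fun j => (Finset.univ.val.map ω).esymm j with hE
  have h' : (k : L) * E k = (-1) ^ (k + 1) *
      ∑ a ∈ (HasAntidiagonal.antidiagonal k).filter (fun a : ℕ × ℕ => a.1 < k),
        (-1) ^ a.1 * E a.1 * ∑ x, ω x ^ a.2 := h
  calc (k : L) * ((-1) ^ k * E k) = (-1) ^ k * ((k : L) * E k) := by ring
    _ = -∑ a ∈ (HasAntidiagonal.antidiagonal k).filter (fun a : ℕ × ℕ => a.1 < k),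
          (-1) ^ a.1 * E a.1 * ∑ x, ω x ^ a.2 := by
        rw [h', ← mul_assoc, ← pow_add, show k + (k + 1) = 2 * k + 1 by ring, pow_succ, pow_mul]
        norm_num
    _ = ∑ a ∈ (HasAntidiagonal.antidiagonal k).filter (fun a : ℕ × ℕ => a.1 < k),
          (-∑ x, ω x ^ a.2) * ((-1) ^ a.1 * E a.1) := by
        rw [← Finset.sum_neg_distrib]
        exact Finset.sum_congr rfl fun a _ => by ring
    _ = ∑ i ∈ Finset.Icc 1 k, (-∑ x, ω x ^ i) * ((-1) ^ (k - i) * E (k - i)) :=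
        sum_antidiagonal_filter_fst_lt k _

/-- Newton's identities for a multiset `ε`: `k (−1)^k e_k(ε) = Σ_{i=1}^k (−p_i(ε)) (−1)^{k−i} e_{k−i}(ε)`
with `p_i(ε) = Σ_{x ∈ ε} x^i`. [cite: Schmidt1976, Ch. II §6, (6.5)] -/
theorem newton_multiset [DecidableEq L] (ε : Multiset L) (k : ℕ) :
    (k : L) * ((-1) ^ k * ε.esymm k) =
      ∑ i ∈ Finset.Icc 1 k, (-(ε.map (· ^ i)).sum) * ((-1) ^ (k - i) * ε.esymm (k - i)) := by
  classical
  have h := newton_eval (fun x : ε => (x : L)) k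
  have hE : ∀ j, (Finset.univ.val.map fun x : ε => (x : L)).esymm j = ε.esymm j := by
    intro j; rw [Multiset.map_univ_coe]
  have hP : ∀ i, ∑ x : ε, (x : L) ^ i = (ε.map (· ^ i)).sum := by
    intro i
    rw [Finset.sum_eq_multiset_sum]
    conv_rhs => rw [← Multiset.map_univ_coe ε]
    rw [Multiset.map_map]
    rfl
  simp only [hE, hP] at h
  exact h

end Newton

/-! ### Products `Π (1 − εX)` and their coefficients -/

section OneSub

variable {L : Type*} [CommRing L]

/-- The recursion of the elementary symmetric functions: `e_{j+1}(a ∷ s) = e_{j+1}(s) + a e_j(s)`.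
[folklore] -/
theorem esymm_cons_succ (a : L) (s : Multiset L) (j : ℕ) :
    (a ::ₘ s).esymm (j + 1) = s.esymm (j + 1) + a * s.esymm j := by
  simp only [Multiset.esymm, Multiset.powersetCard_cons, Multiset.map_add, Multiset.sum_add,
    Multiset.map_map, Function.comp_def, Multiset.prod_cons]
  congr 1
  rw [Multiset.sum_map_mul_left]

/-- **Coefficients of `Π_{e ∈ ε} (1 − eX)`**: the coefficient of `X^j` is `(−1)^j e_j(ε)`. [folklore] -/
theorem coeff_prod_one_sub_C_mul_X (ε : Multiset L) (j : ℕ) :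
    ((ε.map fun e => (1 - C e * X : L[X])).prod).coeff j = (-1) ^ j * ε.esymm j := by
  induction ε using Multiset.induction_on generalizing j with
  | empty =>
    simp only [Multiset.map_zero, Multiset.prod_zero, coeff_one, Multiset.esymm]
    rcases Nat.eq_zero_or_pos j with rfl | hj
    · simp
    · rw [if_neg hj.ne', Multiset.powersetCard_eq_empty _ (by simp; omega)]
      simp
  | cons a s ih =>
    rw [Multiset.map_cons, Multiset.prod_cons]
    rcases Nat.eq_zero_or_pos j with rfl | hj
    · simp only [mul_coeff_zero, coeff_sub, coeff_one_zero, coeff_X_zero, mul_zero,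
        sub_zero, one_mul, ih 0, pow_zero]
      simp [Multiset.esymm]
    · obtain ⟨j, rfl⟩ : ∃ j', j = j' + 1 := ⟨j - 1, by omega⟩
      -- `(1 − aX) P` has `X^{j+1}`-coefficient `P_{j+1} − a P_j`
      have hexp : ((1 - C a * X : L[X]) * (s.map fun e => (1 - C e * X : L[X])).prod).coeff (j + 1) =
          ((s.map fun e => (1 - C e * X : L[X])).prod).coeff (j + 1) -
            a * ((s.map fun e => (1 - C e * X : L[X])).prod).coeff j := by
        rw [sub_mul, one_mul, coeff_sub, mul_assoc, coeff_C_mul, coeff_X_mul]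
      rw [hexp, ih, ih, esymm_cons_succ, pow_succ]
      ring

end OneSub

/-! ### Inverse power sums of shifted roots -/

section InvPowerSum

variable {L : Type*} [Field L]

/-- `u_s(h, γ) = Σ_{β ∈ roots h} (β − γ)^{−s}`, the roots taken with multiplicity (in a field in
which `h` splits; junk otherwise). [cite: Schmidt1976, Ch. II §6 (power sums of roots)] -/
def invPowerSum (h : L[X]) (γ : L) (s : ℕ) : L :=
  (h.roots.map fun β => ((β - γ)⁻¹) ^ s).sum

/-- Additivity: `u_s(h₁h₂, γ) = u_s(h₁, γ) + u_s(h₂, γ)` (`h₁h₂ ≠ 0`). [folklore] -/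
theorem invPowerSum_mul {h₁ h₂ : L[X]} (h : h₁ * h₂ ≠ 0) (γ : L) (s : ℕ) :
    invPowerSum (h₁ * h₂) γ s = invPowerSum h₁ γ s + invPowerSum h₂ γ s := by
  unfold invPowerSum
  rw [roots_mul h, Multiset.map_add, Multiset.sum_add]

/-- **The Taylor expansion at a non-root factors through the inverses of the shifted roots**:
if `h` splits (`#roots = deg h`) and `h(γ) ≠ 0`, then with `ε = {(β − γ)⁻¹ : h(β) = 0}`,
`h(X + γ) = h(γ) · Π_{e ∈ ε} (1 − eX)`. [folklore] -/
theorem taylor_eq_C_mul_prod {h : L[X]} (hsplit : h.roots.card = h.natDegree) {γ : L}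
    (hγ : h.eval γ ≠ 0) :
    taylor γ h = C (h.eval γ) *
      ((h.roots.map fun β => (β - γ)⁻¹).map fun e => (1 - C e * X : L[X])).prod := by
  have h0 : h ≠ 0 := fun h0 => by rw [h0, eval_zero] at hγ; exact hγ rfl
  have hne : ∀ β ∈ h.roots, β - γ ≠ 0 := by
    intro β hβ hβγ
    rw [sub_eq_zero] at hβγ
    rw [hβγ] at hβ
    exact hγ ((mem_roots h0).mp hβ)
  -- `h = lc · Π (X − β)`, so `h(X + γ) = lc · Π (X − (β − γ))`
  have hfac := C_leadingCoeff_mul_prod_multiset_X_sub_C hsplit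
  have htay : taylor γ h = C h.leadingCoeff * ((h.roots.map fun β => β - γ).map fun d => (X - C d : L[X])).prod := by
    conv_lhs => rw [← hfac]
    rw [taylor_apply, C_mul_comp, multiset_prod_comp, Multiset.map_map, Multiset.map_map]
    congr 2
    refine Multiset.map_congr rfl fun β _ => ?_
    simp only [Function.comp_apply, sub_comp, X_comp, C_comp, map_sub]
    ring
  -- `X − d = (−d) · (1 − d⁻¹ X)` for `d ≠ 0`
  have hlin : ∀ β ∈ h.roots, (X - C (β - γ) : L[X]) = C (-(β - γ)) * (1 - C (β - γ)⁻¹ * X) := by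
    intro β hβ
    have hd := hne β hβ
    rw [mul_sub, mul_one, ← mul_assoc, ← C_mul, neg_mul, mul_inv_cancel₀ hd]
    simp only [map_neg, map_one, neg_mul, one_mul, sub_neg_eq_add]
    ring
  have hprod : ((h.roots.map fun β => β - γ).map fun d => (X - C d : L[X])).prod =
      C ((h.roots.map fun β => -(β - γ)).prod) *
        ((h.roots.map fun β => (β - γ)⁻¹).map fun e => (1 - C e * X : L[X])).prod := by
    have e1 : ((h.roots.map fun β => β - γ).map fun d => (X - C d : L[X])) =
        h.roots.map fun β => C (-(β - γ)) * (1 - C (β - γ)⁻¹ * X) := by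
      rw [Multiset.map_map]
      exact Multiset.map_congr rfl fun β hβ => by simp only [Function.comp_apply]; exact hlin β hβ
    rw [e1, Multiset.prod_map_mul, map_multiset_prod C, Multiset.map_map, Multiset.map_map]
    rfl
  -- the constant coefficient identifies `lc · Π (−(β − γ)) = h(γ)`
  have hconst : ((h.roots.map fun β => (β - γ)⁻¹).map fun e => (1 - C e * X : L[X])).prod.coeff 0 = 1 := by
    rw [coeff_prod_one_sub_C_mul_X, pow_zero, one_mul, Multiset.esymm, Multiset.powersetCard_zero_left]
    simp
  have hc0 : h.leadingCoeff * (h.roots.map fun β => -(β - γ)).prod = h.eval γ := by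
    have := congrArg (fun p : L[X] => p.coeff 0) htay
    simp only [taylor_coeff_zero, hprod, ← mul_assoc, ← C_mul, coeff_C_mul, hconst, mul_one] at this
    exact this.symm
  rw [htay, hprod, ← mul_assoc, ← C_mul, hc0]

/-- **Taylor coefficients at a non-root**: `d_j = h(γ) · (−1)^j e_j(ε)` for all `j`, with
`ε = {(β − γ)⁻¹}` as above. [folklore] -/
theorem coeff_taylor_eq {h : L[X]} (hsplit : h.roots.card = h.natDegree) {γ : L}
    (hγ : h.eval γ ≠ 0) (j : ℕ) :
    (taylor γ h).coeff j = h.eval γ * ((-1) ^ j * (h.roots.map fun β => (β - γ)⁻¹).esymm j) := by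
  rw [taylor_eq_C_mul_prod hsplit hγ, coeff_C_mul, coeff_prod_one_sub_C_mul_X]

/-- **Newton's recursion at a pole**: if `h` splits and `h(γ) ≠ 0`, the Taylor coefficients
`d_j = [X^j] h(X + γ)` and the inverse power sums `u_i = Σ_{h(β)=0} (β − γ)^{−i}` satisfy
`k d_k = −Σ_{i=1}^{k} u_i d_{k−i}` for every `k`.
[cite: Schmidt1976, Ch. II §6, (6.5)–(6.6)] -/
theorem natCast_mul_coeff_taylor_eq [DecidableEq L] {h : L[X]} (hsplit : h.roots.card = h.natDegree)
    {γ : L} (hγ : h.eval γ ≠ 0) (k : ℕ) :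
    (k : L) * (taylor γ h).coeff k =
      -∑ i ∈ Finset.Icc 1 k, invPowerSum h γ i * (taylor γ h).coeff (k - i) := by
  set ε : Multiset L := h.roots.map fun β => (β - γ)⁻¹ with hε
  have hnewton := newton_multiset ε k
  have hu : ∀ i, (ε.map (· ^ i)).sum = invPowerSum h γ i := by
    intro i; unfold invPowerSum; rw [hε, Multiset.map_map]; rfl
  simp only [hu] at hnewton
  rw [coeff_taylor_eq hsplit hγ k, mul_left_comm, hnewton, Finset.mul_sum, ← Finset.sum_neg_distrib]
  refine Finset.sum_congr rfl fun i _ => ?_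
  rw [coeff_taylor_eq hsplit hγ (k - i)]
  ring

/-- **`u_1, …, u_m` are determined by `d_0, …, d_m`**: if two polynomials split, do not vanish
at `γ`, and have the same Taylor coefficients at `γ` up to order `m`, then their inverse power
sums at `γ` agree up to order `m`. [folklore] -/
theorem invPowerSum_eq_of_coeff_taylor_eq [DecidableEq L] {h₁ h₂ : L[X]}
    (hs₁ : h₁.roots.card = h₁.natDegree) (hs₂ : h₂.roots.card = h₂.natDegree) {γ : L}
    (hγ₁ : h₁.eval γ ≠ 0) (hγ₂ : h₂.eval γ ≠ 0) {m : ℕ}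
    (hcoeff : ∀ j ≤ m, (taylor γ h₁).coeff j = (taylor γ h₂).coeff j) :
    ∀ k, 1 ≤ k → k ≤ m → invPowerSum h₁ γ k = invPowerSum h₂ γ k := by
  intro k
  induction k using Nat.strong_induction_on with
  | _ k ih =>
    intro hk1 hkm
    obtain ⟨n, rfl⟩ : ∃ n, k = n + 1 := ⟨k - 1, by omega⟩
    have e1 := natCast_mul_coeff_taylor_eq hs₁ hγ₁ (n + 1)
    have e2 := natCast_mul_coeff_taylor_eq hs₂ hγ₂ (n + 1)
    -- split off the term `i = n + 1`, which is `u_{n+1} d_0`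
    rw [Finset.sum_Icc_succ_top (by omega : 1 ≤ n + 1), Nat.sub_self] at e1 e2
    -- the remaining sums agree by the induction hypothesis and the hypothesis on coefficients
    have hih : ∑ i ∈ Finset.Icc 1 n, invPowerSum h₁ γ i * (taylor γ h₁).coeff (n + 1 - i) =
        ∑ i ∈ Finset.Icc 1 n, invPowerSum h₂ γ i * (taylor γ h₂).coeff (n + 1 - i) := by
      refine Finset.sum_congr rfl fun i hi => ?_
      rw [Finset.mem_Icc] at hi
      rw [ih i (by omega) hi.1 (by omega), hcoeff (n + 1 - i) (by omega)]
    rw [hcoeff (n + 1) hkm, hih, hcoeff 0 (Nat.zero_le _)] at e1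
    have h3 : invPowerSum h₁ γ (n + 1) * (taylor γ h₂).coeff 0 =
        invPowerSum h₂ γ (n + 1) * (taylor γ h₂).coeff 0 := by
      have := e1.symm.trans e2
      rw [neg_inj] at this
      exact add_left_cancel this
    rw [taylor_coeff_zero] at h3
    exact mul_right_cancel₀ hγ₂ h3

/-- Congruence modulo `(X − γ)^{m+1}` gives equal Taylor coefficients up to order `m`. [folklore] -/
theorem coeff_taylor_eq_of_dvd_sub {h₁ h₂ : L[X]} {γ : L} {m : ℕ}
    (hdvd : (X - C γ) ^ (m + 1) ∣ h₁ - h₂) : ∀ j ≤ m, (taylor γ h₁).coeff j = (taylor γ h₂).coeff j := by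
  intro j hj
  obtain ⟨k, hk⟩ := hdvd
  have h1 : h₁ = h₂ + (X - C γ) ^ (m + 1) * k := by rw [← hk]; ring
  have htX : taylor γ ((X - C γ) ^ (m + 1) * k) = X ^ (m + 1) * taylor γ k := by
    rw [taylor_mul, taylor_pow, map_sub, taylor_X, taylor_C, add_sub_cancel_right]
  rw [h1, map_add, htX, coeff_add, coeff_X_pow_mul', if_neg (by omega), add_zero]

/-- **`u_1, …, u_m` depend only on `h mod (X − γ)^{m+1}`**: for split `h₁, h₂` not vanishing
at `γ` with `(X − γ)^{m+1} ∣ h₁ − h₂`, `invPowerSum h₁ γ k = invPowerSum h₂ γ k` for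
`1 ≤ k ≤ m`. [cite: Schmidt1976, Ch. II §6 (via Newton's formulae)] -/
theorem invPowerSum_eq_of_dvd_sub [DecidableEq L] {h₁ h₂ : L[X]}
    (hs₁ : h₁.roots.card = h₁.natDegree) (hs₂ : h₂.roots.card = h₂.natDegree) {γ : L}
    (hγ₁ : h₁.eval γ ≠ 0) (hγ₂ : h₂.eval γ ≠ 0) {m : ℕ} (hdvd : (X - C γ) ^ (m + 1) ∣ h₁ - h₂) :
    ∀ k, 1 ≤ k → k ≤ m → invPowerSum h₁ γ k = invPowerSum h₂ γ k :=
  invPowerSum_eq_of_coeff_taylor_eq hs₁ hs₂ hγ₁ hγ₂ (coeff_taylor_eq_of_dvd_sub hdvd)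

end InvPowerSum

end RationalExpSum

end Literature.NumberTheory.LFunctions
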